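import Summits.Langlands.Langlands.Theorems.ParityBlindBianchiTwoAdicBianchiProModularityLevelSqueezeDefsLoci
import Summits.Langlands.Langlands.Theorems.ParityBlindBianchiTwoAdicBianchiProModularityLevelSqueezeReadoutOfHeckeClosed
import Summits.Langlands.Langlands.Theorems.ParityBlindBianchiTwoAdicBianchiProModularityLevelSqueezeArtinTypePointD
import HarnessLib

/-!
# Line `dimension-squeeze` (crux `TwoAdicBianchiProModularityLevel`, stmt-Langlands-15110): READ for the loci of an
# arbitrary ideal (v3)

Generic (any ideal `I` of the universal ring) forms of the READ reductions landed by the READ stub-worker of lead c14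
(`…SqueezeReadoutOfHeckeClosed.lean`, p139842): with `x_σ` a point of `V(I)` (for `I = typeIdealD`:
`squeeze_exists_artinTypePointD`), `heckeIdealOf I U ≤ locusOf I` and the HECKE HALF "the Hecke points of `V(I)` at level
`U` are Zariski closed among the points of `V(I)`" give the crux's conclusion `IsPointAt K S₀ U ϖ a`; and the Hecke half
follows from a Hecke quotient `q : R ↠ T` of `V(I)`-type (the lead's `HeckeAlgebraDatum` minus its dimension fields).
Registered sub-goals `squeeze_zariskiReadoutOf_of_heckePointsClosed`, `squeeze_zariskiReadoutOf_of_heckeAlgebra`; the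
v3 `stub_zariskiReadout` is their instance `I = typeIdealD`. [cite: Scholze2015, §V.4] [cite: Mazur1997Deformation, §20 Prop. 2]
-/

noncomputable section

set_option linter.dupNamespace false -- `Summit.Langlands.Langlands` is the mandated namespace (D-0017)

open scoped NumberField MatrixGroups
open Polynomial IsDedekindDomain Field
open Literature.NumberTheory.GaloisRepresentations Literature.NumberTheory.Automorphic

namespace Summit.Langlands.Langlands.Cruxes.TwoAdicBianchiProModularityLevel.DimensionSqueeze

/-- REGISTERED SUB-GOAL `squeeze_zariskiReadoutOf_of_heckePointsClosed` (READ, generic form): **if the Artin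
point `emb ∘ φ` (with `φ ∘ ρ^univ` strictly equivalent to `σ_𝒪`) is a point of `V(I)`, the Hecke points of `V(I)` at
level `U` are Zariski closed among the points of `V(I)`, and `heckeIdealOf I U ≤ locusOf I`, then the Hansen data `a`
of `σ` are a point of `Spf 𝕋(U²)`.** [cite: Mazur1997Deformation, §20 Prop. 2] -/
theorem squeeze_zariskiReadoutOf_of_heckePointsClosed : ∀ (K : Type) [Field K] [NumberField K]
    (σ : FramedGaloisRep K (PadicAlgCl 2) 2) (S₀ : Finset ℕ) (h0 : (0 : ℕ) ∉ S₀) (h2 : 2 ∈ S₀)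
    (ϖ : ∀ v : HeightOneSpectrum (𝓞 K), (v.adicCompletion K)ˣ) (a : Good K S₀ → ℕ → O2),
    (∀ (v : HeightOneSpectrum (𝓞 K)) (hv : ∀ ℓ ∈ S₀, ((ℓ : ℕ) : 𝓞 K) ∉ v.asIdeal),
      σ.IsHeckeAssociatedAt v
        (fun i : ℕ => if i = 0 then (1 : PadicAlgCl 2) else (a ⟨v, hv⟩ i : PadicAlgCl 2))) →
    ∀ (M : Model σ) (hunr : ∀ v ∉ badSet K S₀, Deformation.IsUnramifiedAt v M.residual)
      (𝓡 : PolarizedDeformationRing (M.datum S₀ h0 h2 hunr)) (I : Ideal 𝓡.R)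
      (U : Subgroup (GL (Fin 2) (FiniteAdeleRing (𝓞 K) K))) (φ : 𝓡.R →ₐ[M.𝒪] M.𝒪),
    Deformation.IsStrictEquiv (algebraMap M.𝒪 M.k)
      ((Matrix.GeneralLinearGroup.map (φ : 𝓡.R →+* M.𝒪)).comp 𝓡.ρ) M.σ𝒪 →
    M.emb.comp (φ : 𝓡.R →+* M.𝒪) ∈ M.pointsOf 𝓡 I →
    (∀ x ∈ M.pointsOf 𝓡 I, M.heckeIdealOf 𝓡 I U ϖ ≤ RingHom.ker x → x ∈ M.heckePointsOf 𝓡 I U ϖ) →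
    M.heckeIdealOf 𝓡 I U ϖ ≤ M.locusOf 𝓡 I → IsPointAt K S₀ U ϖ a := by
  intro K _ _ σ S₀ h0 h2 ϖ a hassoc M hunr 𝓡 I U φ hφ htype hclosed hle
  have hker : M.heckeIdealOf 𝓡 I U ϖ ≤ RingHom.ker (M.emb.comp (φ : 𝓡.R →+* M.𝒪)) :=
    hle.trans (iInf₂_le _ htype)
  obtain ⟨-, b, hb, hbpt⟩ := hclosed _ htype hker
  refine isPointAt_congr (fun w => ?_) hbpt
  have ha : IsAssocBare K (M.pointRep 𝓡 (M.emb.comp (φ : 𝓡.R →+* M.𝒪))) w.1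
      (fun i : ℕ => if i = 0 then (1 : PadicAlgCl 2) else (a ⟨w.1, w.2⟩ i : PadicAlgCl 2)) :=
    M.isAssocBare_pointRep_artin 𝓡 φ hφ (hassoc w.1 w.2)
  obtain ⟨h1, h2'⟩ := ha.eq_of_isAssocBare (hb w.1 w.2)
  simp only [one_ne_zero, if_false, OfNat.ofNat_ne_zero] at h1 h2'
  exact ⟨Subtype.ext h1, Subtype.ext h2'⟩

/-- **The Hecke points of `V(I)` are Zariski closed among the points of `V(I)` as soon as they all factor through a
quotient `q : R ↠ T` whose `𝒪_{ℚ̄₂}`-points over points of `V(I)` are Hecke points.** [cite: Scholze2015, §V.4] -/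
theorem squeeze_heckePointsOfClosed_of_heckeQuotient {K : Type} [Field K] [NumberField K]
    {σ : FramedGaloisRep K (PadicAlgCl 2) 2} (M : Model σ) {S₀ : Finset ℕ} {h0 : (0 : ℕ) ∉ S₀}
    {h2 : 2 ∈ S₀} {hunr : ∀ v ∉ badSet K S₀, Deformation.IsUnramifiedAt v M.residual}
    (𝓡 : PolarizedDeformationRing (M.datum S₀ h0 h2 hunr)) (I : Ideal 𝓡.R)
    (U : Subgroup (GL (Fin 2) (FiniteAdeleRing (𝓞 K) K)))
    (ϖ : ∀ v : HeightOneSpectrum (𝓞 K), (v.adicCompletion K)ˣ)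
    {T : Type*} [CommRing T] (q : 𝓡.R →+* T) (hq : Function.Surjective q)
    (hqJ : RingHom.ker q ≤ M.heckeIdealOf 𝓡 I U ϖ)
    (hT : ∀ ψ : T →+* O2, ψ.comp q ∈ M.pointsOf 𝓡 I → ψ.comp q ∈ M.heckePointsOf 𝓡 I U ϖ) :
    ∀ x ∈ M.pointsOf 𝓡 I, M.heckeIdealOf 𝓡 I U ϖ ≤ RingHom.ker x → x ∈ M.heckePointsOf 𝓡 I U ϖ := by
  intro x hx hJx
  set ψ : T →+* O2 := q.liftOfSurjective hq ⟨x, hqJ.trans hJx⟩ with hψ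
  have hψq : ψ.comp q = x := q.liftOfSurjective_comp hq ⟨x, hqJ.trans hJx⟩
  rw [← hψq] at hx ⊢
  exact hT ψ hx

/-- REGISTERED SUB-GOAL `squeeze_zariskiReadoutOf_of_heckeAlgebra` (READ, generic form, from the data of a Hecke
quotient): for an `𝒪`-algebra surjection `q : R ↠ T` all of whose `𝒪`-algebra points `ψ : T → 𝒪_{ℚ̄₂}` give Hecke
points `ψ ∘ q` of `V(I)` and through which every Hecke point of `V(I)` factors (`ker q ≤ heckeIdealOf I U`), and with
the Artin point a point of `V(I)`: `heckeIdealOf I U ≤ locusOf I` implies that the Hansen data of `σ` are a point of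
`Spf 𝕋(U²)`. [cite: Scholze2015, §V.4] -/
theorem squeeze_zariskiReadoutOf_of_heckeAlgebra : ∀ (K : Type) [Field K] [NumberField K]
    (σ : FramedGaloisRep K (PadicAlgCl 2) 2) (S₀ : Finset ℕ) (h0 : (0 : ℕ) ∉ S₀) (h2 : 2 ∈ S₀)
    (ϖ : ∀ v : HeightOneSpectrum (𝓞 K), (v.adicCompletion K)ˣ) (a : Good K S₀ → ℕ → O2),
    (∀ (v : HeightOneSpectrum (𝓞 K)) (hv : ∀ ℓ ∈ S₀, ((ℓ : ℕ) : 𝓞 K) ∉ v.asIdeal),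
      σ.IsHeckeAssociatedAt v
        (fun i : ℕ => if i = 0 then (1 : PadicAlgCl 2) else (a ⟨v, hv⟩ i : PadicAlgCl 2))) →
    ∀ (M : Model σ) (hunr : ∀ v ∉ badSet K S₀, Deformation.IsUnramifiedAt v M.residual)
      (𝓡 : PolarizedDeformationRing (M.datum S₀ h0 h2 hunr)) (I : Ideal 𝓡.R)
      (U : Subgroup (GL (Fin 2) (FiniteAdeleRing (𝓞 K) K))) (φ : 𝓡.R →ₐ[M.𝒪] M.𝒪),
    Deformation.IsStrictEquiv (algebraMap M.𝒪 M.k)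
      ((Matrix.GeneralLinearGroup.map (φ : 𝓡.R →+* M.𝒪)).comp 𝓡.ρ) M.σ𝒪 →
    M.emb.comp (φ : 𝓡.R →+* M.𝒪) ∈ M.pointsOf 𝓡 I →
    ∀ (T : Type) [CommRing T] [Algebra M.𝒪 T] (q : 𝓡.R →ₐ[M.𝒪] T), Function.Surjective q →
    RingHom.ker (q : 𝓡.R →+* T) ≤ M.heckeIdealOf 𝓡 I U ϖ →
    (∀ ψ : T →+* O2, ψ.comp (algebraMap M.𝒪 T) = M.emb →
      ψ.comp (q : 𝓡.R →+* T) ∈ M.heckePointsOf 𝓡 I U ϖ) →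
    M.heckeIdealOf 𝓡 I U ϖ ≤ M.locusOf 𝓡 I → IsPointAt K S₀ U ϖ a := by
  intro K _ _ σ S₀ h0 h2 ϖ a hassoc M hunr 𝓡 I U φ hφ htype T _ _ q hq hqJ hHecke hle
  refine squeeze_zariskiReadoutOf_of_heckePointsClosed K σ S₀ h0 h2 ϖ a hassoc M hunr 𝓡 I U φ hφ htype
    (squeeze_heckePointsOfClosed_of_heckeQuotient M 𝓡 I U ϖ (q : 𝓡.R →+* T) hq hqJ fun ψ hψ => hHecke ψ ?_) hle
  -- `ψ ∘ (𝒪 → T) = (ψ ∘ q) ∘ (𝒪 → R) = emb`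
  rw [← hψ.1, RingHom.comp_assoc]
  congr 1
  exact RingHom.ext fun y => (q.commutes y).symm

end Summit.Langlands.Langlands.Cruxes.TwoAdicBianchiProModularityLevel.DimensionSqueeze

end
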